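import Summits.ValiantsHypothesis.ValiantsHypothesis.Theorems.LacunarySymmetroidMatrixDescartesWLawArrow
import Summits.ValiantsHypothesis.ValiantsHypothesis.Theorems.LacunarySymmetroidMatrixDescartesCensusPivotDefs

/-!
# `MatrixDescartes` (stmt-ValiantsHypothesis-18050) — the arrowhead W-configurations in the PIVOT currency:
# `¬ PivotRootLawAt m 3 1 (4m − 3)` for EVERY `m`; the bilinear rank-one pivot law is SHARP along `K = 3` if true

HONEST FRAMING.  Cell `pub-symmetroid`, seat `val-sym-mdr-p2` (gen 8); helper file `--supports` the crux
`Theses.LacunarySymmetroid.MatrixDescartes` (OPEN), NO closure claim.  Bookkeeping between two typed row families of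
the cell: the W-law rows `WLawAt n B` (`…WLawDefs`) and conjb-1's pivot rows `Pivot.PivotRootLawAt m K q B`
(`…CensusPivotDefs`: every `m × m` pivot pencil `X^e J + ∑ₖ X^{dₖ} Pₖ` with `K` PSD letters and `J` of negative index
`≤ q` has `Z₊ ≤ B`).  Nothing here bears on `MatrixDescartes` in its window, on `stub_twoSided`, `DoorA26` / `DoorA34`,
the census registers, or `VP ≠ VNP`.

CONTENT.  The arrowhead W-configurations of `…WLawArrow` (`4k + 2` distinct positive roots in size `k + 1`) have a
DIAGONAL pivot letter `J = diag(5Ξᵢ⁴/Uᵢ, …, −1 − 5∑Uᵢ)` with exactly ONE negative entry, so `J + W Wᵀ ⪰ 0` for the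
column `W = (0, …, 0, √(1 + 5∑Uᵢ))ᵀ`: they are pivot pencils of format `(m, K) = (k+1, 3)` and index `1`
(`exists_wConfig_arrow_indexOne`).  Hence **`not_pivotRootLawAt_three_one : 1 ≤ m → ¬ PivotRootLawAt m 3 1 (4m − 3)`**
(`Z₊ ≥ 4m − 2` at `(m, 3)`, index `1`, every `m`; the tree had `Z₊ ≥ 3m` at even `m` with index `m/2`,
`Pivot.not_pivotRootLawAt_three_of_even`), and `le_of_pivotRootLawAt_three_one : PivotRootLawAt m 3 1 B → 4m − 2 ≤ B`.
The typed bilinear guess `Pivot.RankOnePivotLawBilinear : ∀ m K, PivotRootLawAt m K 1 (2(m−1)(K−1) + 2)` (conjb-1 g2,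
NOT asserted) has budget EXACTLY `4m − 2` at `K = 3`: **if it holds it is sharp along the whole `K = 3` column**
(`pivotRootLawAt_three_one_iff_of_bilinear : RankOnePivotLawBilinear → (PivotRootLawAt m 3 1 B ↔ 4m − 2 ≤ B)`), as it is
along `K = 2` by the V-law.  The flattened-block count of `…WLawArrow` («2(K−1) per block + 2 ends») predicts the same
sharpness `2(m−1)(K−1) + 2` at every `(m, K)`; only `K ≤ 3` is in the kernel.

[folklore] Bookkeeping over the tree files `…WLawArrow`, `…WLawArrowLetters`, `…WLawArrowKit`, `…CensusPivotDefs`.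
Axioms `propext`, `Classical.choice`, `Quot.sound`.
-/

set_option linter.dupNamespace false

namespace Summit.ValiantsHypothesis.ValiantsHypothesis.Theorems.LacunarySymmetroidMatrixDescartes

open scoped BigOperators Topology Matrix
open Filter Matrix Polynomial

namespace WLawArrow

/-- The reference block shape (as in the kit file; local notation, no definition). -/
local notation3 (prettyPrint := false) "φ[" y "]" =>
  (5 * (y : ℝ) ^ 2 * (1 - 5 * (y : ℝ) + 5 * (y : ℝ) ^ 2 - (y : ℝ) ^ 3))
    / (5 + 25 * (y : ℝ) ^ 2 + 5 * (y : ℝ) ^ 3 + (y : ℝ) ^ 5)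

/-- The scalar model (as in the kit file; local notation, no definition). -/
local notation3 (prettyPrint := false) "M[" Ξ ", " U "](" x ")" =>
  ((x : ℝ)⁻¹ ^ 3 - 1 + ∑ i, (U : Fin _ → ℝ) i * φ[(x : ℝ) / (Ξ : Fin _ → ℝ) i])

/-- The arrowhead letter `P₂` (as in `…WLawArrowLetters`; local notation, no definition). -/
local notation3 (prettyPrint := false) "P₂blk[" Ξ ", " U "]" =>
  Matrix.fromBlocks (diagonal fun i => 5 * (Ξ : Fin _ → ℝ) i ^ 7 / (U : Fin _ → ℝ) i)
    (Matrix.of fun (i : Fin _) (_ : Fin 1) => -(5 * (Ξ : Fin _ → ℝ) i ^ 5))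
    (Matrix.of fun (_ : Fin 1) (i : Fin _) => -(5 * (Ξ : Fin _ → ℝ) i ^ 5))
    (Matrix.of fun (_ _ : Fin 1) => (∑ i, 5 * (U : Fin _ → ℝ) i * (Ξ : Fin _ → ℝ) i ^ 3) + 1)

/-- The arrowhead letter `P₁` (local notation, no definition). -/
local notation3 (prettyPrint := false) "P₁blk[" Ξ ", " U "]" =>
  Matrix.fromBlocks (diagonal fun i => 25 * (Ξ : Fin _ → ℝ) i ^ 5 / (U : Fin _ → ℝ) i)
    (Matrix.of fun (i : Fin _) (_ : Fin 1) => -(25 * (Ξ : Fin _ → ℝ) i ^ 3))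
    (Matrix.of fun (_ : Fin 1) (i : Fin _) => -(25 * (Ξ : Fin _ → ℝ) i ^ 3))
    (Matrix.of fun (_ _ : Fin 1) => ∑ i, 25 * (U : Fin _ → ℝ) i * (Ξ : Fin _ → ℝ) i)

/-- The diagonal letter `J` (local notation, no definition). -/
local notation3 (prettyPrint := false) "Jblk[" Ξ ", " U "]" =>
  Matrix.fromBlocks (diagonal fun i => 5 * (Ξ : Fin _ → ℝ) i ^ 4 / (U : Fin _ → ℝ) i) 0 0
    (Matrix.of fun (_ _ : Fin 1) => -1 - 5 * ∑ i, (U : Fin _ → ℝ) i)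

/-- The diagonal letter `Q` (local notation, no definition). -/
local notation3 (prettyPrint := false) "Qblk[" Ξ ", " U ", " s "]" =>
  Matrix.fromBlocks (diagonal fun i => (Ξ : Fin _ → ℝ) i ^ 2 / (U : Fin _ → ℝ) i) 0 0
    (Matrix.of fun (_ _ : Fin 1) => (s : ℝ))

/-- Reindexing `Fin k ⊕ Fin 1 ≃ Fin (k + 1)` (local notation). -/
local notation3 (prettyPrint := false) "rx[" A "]" => Matrix.reindex finSumFinEquiv finSumFinEquiv A

/-- **The pivot letter `J` has index one**: `J + W Wᵀ ⪰ 0` for the column `W = (0, …, 0, √(1 + 5∑Uᵢ))ᵀ`.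
[folklore] -/
theorem indexOne_J {k : ℕ} (Ξ U : Fin k → ℝ) (hU : ∀ i, 0 < U i) :
    ∃ W : Matrix (Fin (k + 1)) (Fin 1) ℝ, (rx[Jblk[Ξ, U]] + W * Wᵀ).PosSemidef := by
  set c : ℝ := 1 + 5 * ∑ i, U i with hc
  have hc0 : 0 ≤ c := by
    rw [hc]
    have : 0 ≤ ∑ i, U i := Finset.sum_nonneg fun i _ => (hU i).le
    linarith
  -- the column on `Fin k ⊕ Fin 1` and its reindexed version
  set W₀ : Matrix (Fin k ⊕ Fin 1) (Fin 1) ℝ := Matrix.of (Sum.elim (fun _ _ => (0 : ℝ)) fun _ _ => Real.sqrt c)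
    with hW₀
  refine ⟨W₀.submatrix finSumFinEquiv.symm (Equiv.refl (Fin 1)), ?_⟩
  have hblock : Jblk[Ξ, U] + W₀ * W₀ᵀ
      = Matrix.fromBlocks (diagonal fun i => 5 * Ξ i ^ 4 / U i) 0 0 (0 : Matrix (Fin 1) (Fin 1) ℝ) := by
    ext i j
    rcases i with i | i <;> rcases j with j | j
    · simp [hW₀, Matrix.mul_apply, Matrix.fromBlocks]
    · simp [hW₀, Matrix.mul_apply, Matrix.fromBlocks]
    · simp [hW₀, Matrix.mul_apply, Matrix.fromBlocks]
    · simp only [hW₀, Matrix.add_apply, Matrix.fromBlocks_apply₂₂, Matrix.of_apply, Matrix.mul_apply,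
        Matrix.transpose_apply, Sum.elim_inr, Finset.sum_const, Finset.card_univ, Fintype.card_fin,
        nsmul_eq_mul, Nat.cast_one, one_mul, Matrix.zero_apply]
      rw [Real.mul_self_sqrt hc0, hc]
      ring
  have hrx : rx[Jblk[Ξ, U]] + W₀.submatrix finSumFinEquiv.symm (Equiv.refl (Fin 1))
        * (W₀.submatrix finSumFinEquiv.symm (Equiv.refl (Fin 1)))ᵀ
      = rx[Jblk[Ξ, U] + W₀ * W₀ᵀ] := by
    rw [Matrix.transpose_submatrix, Matrix.reindex_apply, Matrix.reindex_apply, Matrix.submatrix_add]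
    congr 1
  rw [hrx, hblock, Matrix.reindex_apply]
  refine Matrix.PosSemidef.submatrix ?_ _
  refine posSemidef_fromBlocks_zero (posSemidef_diagonal_iff.2 fun i => ?_) Matrix.PosSemidef.zero
  have := hU i
  positivity

/-- **The arrowhead witnesses are pivot pencils of index one.**  For every `k`: an explicit `(k+1) × (k+1)`
W-configuration on `(3; 2, 0; 5)` with `J + W Wᵀ ⪰ 0` for a single column `W` and at least `4k + 2` distinct
positive determinant roots. [folklore] -/
theorem exists_wConfig_arrow_indexOne (k : ℕ) :
    ∃ (J P₁ P₂ Q : Matrix (Fin (k + 1)) (Fin (k + 1)) ℝ) (W : Matrix (Fin (k + 1)) (Fin 1) ℝ),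
      J.IsSymm ∧ P₁.PosSemidef ∧ P₂.PosSemidef ∧ Q.PosSemidef ∧ (J + W * Wᵀ).PosSemidef ∧
      4 * k + 2 ≤ ((Matrix.det (((X : ℝ[X]) ^ 3) • J.map Polynomial.C + ((X : ℝ[X]) ^ 2) • P₁.map Polynomial.C
        + ((X : ℝ[X]) ^ 0) • P₂.map Polynomial.C + ((X : ℝ[X]) ^ 5) • Q.map Polynomial.C)).roots.toFinset.filter
          (fun t => 0 < t)).card := by
  obtain ⟨Ξ, U, σ, hΞ, hU, hanti, hpos, hsign⟩ := model_alternates k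
  obtain ⟨s, Xr, hs, hX, hXval, hsigns⟩ := end_step Ξ U hΞ σ hsign
  obtain ⟨W, hW⟩ := indexOne_J Ξ U hU
  refine ⟨rx[Jblk[Ξ, U]], rx[P₁blk[Ξ, U]], rx[P₂blk[Ξ, U]], rx[Qblk[Ξ, U, s]], W, isSymm_J Ξ U,
    posSemidef_P₁ Ξ U hΞ hU, posSemidef_P₂ Ξ U hΞ hU, posSemidef_Q Ξ U hU hs.le, hW, ?_⟩
  have hρpos : ∀ j, 0 < (vecCons Xr σ) j := by
    intro j
    refine Fin.cases ?_ (fun i => ?_) j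
    · simpa using (hpos 0).trans hX
    · simpa using hpos i
  refine le_card_posRoots_of_alternating_anti _ (4 * k + 1 + 1) (vecCons Xr σ) (hanti.vecCons hX) hρpos
    fun j => ?_
  refine Fin.cases ?_ (fun i => ?_) j
  · have h0 := hsigns 0
    simp only [Fin.val_zero, zero_add, pow_one] at h0
    rw [Fin.castSucc_zero, Matrix.cons_val_zero, Fin.succ_zero_eq_one, Matrix.cons_val_one]
    exact eval_mul_eval_neg Ξ U hΞ hU s ((hpos 0).trans hX) (hpos 0) (mul_neg_of_pos_of_neg hXval (by linarith))
  · rw [← Fin.succ_castSucc, Matrix.cons_val_succ, Matrix.cons_val_succ]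
    exact eval_mul_eval_neg Ξ U hΞ hU s (hpos _) (hpos _)
      (prod_neg_of_alt (fun x => M[Ξ, U](x) + s * x ^ 2) σ hsigns i)

end WLawArrow

/-- **`Z₊ ≥ 4m − 2` AT `(m, K) = (m, 3)`, INDEX ONE, EVERY `m`**: `¬ PivotRootLawAt m 3 1 (4m − 3)` for all `m ≥ 1`.
[folklore] -/
theorem not_pivotRootLawAt_three_one {m : ℕ} (hm : 1 ≤ m) : ¬ Pivot.PivotRootLawAt m 3 1 (4 * m - 3) := by
  obtain ⟨k, rfl⟩ : ∃ k, m = k + 1 := ⟨m - 1, by omega⟩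
  intro h
  obtain ⟨J, P₁, P₂, Q, W, hJ, hP₁, hP₂, hQ, hW, hA⟩ := WLawArrow.exists_wConfig_arrow_indexOne k
  have hP : ∀ j : Fin 3, ((![P₁, P₂, Q] : Fin 3 → Matrix (Fin (k + 1)) (Fin (k + 1)) ℝ) j).PosSemidef := by
    intro j
    fin_cases j
    · simpa using hP₁
    · simpa using hP₂
    · simpa using hQ
  have h5 := h 3 ![2, 0, 5] J ![P₁, P₂, Q] hJ hP ⟨W, hW⟩
  unfold Pivot.pivotPosRoots at h5
  simp only [Fin.sum_univ_three, Matrix.cons_val_zero, Matrix.cons_val_one, Matrix.cons_val_two,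
    Matrix.head_cons, Matrix.tail_cons, ← add_assoc] at h5
  omega

/-- In law form: `PivotRootLawAt m 3 1 B → 4m − 2 ≤ B` (`m ≥ 1`). [bookkeeping] -/
theorem le_of_pivotRootLawAt_three_one {m B : ℕ} (hm : 1 ≤ m) (h : Pivot.PivotRootLawAt m 3 1 B) :
    4 * m - 2 ≤ B := by
  by_contra hB
  exact not_pivotRootLawAt_three_one hm (Pivot.pivotRootLawAt_mono h (by omega))

/-- **The bilinear rank-one pivot law is SHARP along `K = 3` if it holds**: under
`RankOnePivotLawBilinear` (typed, NOT asserted), `PivotRootLawAt m 3 1 B ↔ 4m − 2 ≤ B` for every `m ≥ 1`.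
[bookkeeping] -/
theorem pivotRootLawAt_three_one_iff_of_bilinear (hbil : Pivot.RankOnePivotLawBilinear) {m B : ℕ} (hm : 1 ≤ m) :
    Pivot.PivotRootLawAt m 3 1 B ↔ 4 * m - 2 ≤ B := by
  refine ⟨le_of_pivotRootLawAt_three_one hm, fun hB => ?_⟩
  have h := hbil m 3
  refine Pivot.pivotRootLawAt_mono h ?_
  omega

end Summit.ValiantsHypothesis.ValiantsHypothesis.Theorems.LacunarySymmetroidMatrixDescartes
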